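import Literature.NumberTheory.Sieve.IwaniecAlmostPrimesWeightedSum
import HarnessLib

/-!
# Prime sums of the Buchstab iteration for the friable Möbius–root sum, I: the wrapper and two error sums

Topic `Literature/NumberTheory/Sieve` (inputs of the inductive step of the friable Möbius–root sum
asymptotics, `FriableMoebiusRootSumStep.lean`). Everything here is PROVED; no definitions, no named
facts. The prime weights are an arbitrary `r : ℕ → ℝ` (think `r(p) = ρ_g(p)`, the root count of a
polynomial) subject only to **Mertens' second theorem with rate**:

`|∑_{p ≤ t} r(p)/p − (log log t + b₀)| ≤ C_E/log² t`  (`t ≥ 2`).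

Writing `S = {primes p : ⌊a⌋ < p ≤ ⌊b⌋}`, `L = log x`, `α = log a/L`, `β = log b/L`:

* `abs_primeSum_sub_integral_le` — the tree's quantitative Abel summation against `log log`
  (`Iwaniec1978.abs_sum_mul_sub_integral_le`) specialised to these weights:
  `|∑_{p ∈ S} (r(p)/p) G(log p/L) − ∫_α^β G(v) dv/v| ≤ (|G(α)| + |G(β)| + ∫_α^β |G'|) C_E/log² a`;
* `sum_prime_div_mul_log_sq_le` — `∑_{p ∈ S} r(p)/(p log² p) ≤ (1/2 + 3C_E)/log² a` (`e ≤ a ≤ b < x`);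
* `sum_prime_boundaryLayer_le` — for `2 log b ≤ log x`:
  `∑_{p ∈ S} (r(p)/p)/(1 + log x − 2 log p)² ≤ (1/2 + 3C_E)/log a`
  (the sum of the boundary-layer terms `|R(x/p²) − C|` of the friable Möbius–root sums `G(x/p, p)`).

## References

* H. Iwaniec, *Almost-primes represented by quadratic polynomials*, Invent. Math. 47 (1978),
  171–188, p. 186 (partial summation against `log log`). [IwaniecInventiones1978]
* H. L. Montgomery, R. C. Vaughan, *Multiplicative Number Theory I*, CUP 2007, §2.1. [MontgomeryVaughan2007]
-/

open Finset Real MeasureTheory Set intervalIntegral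

noncomputable section

namespace Literature.NumberTheory.Sieve

namespace FriableMoebiusRoot

/-! ### The wrapper -/

/-- The constant of a Mertens hypothesis with rate is nonnegative. [folklore] -/
theorem mertensConst_nonneg {r : ℕ → ℝ} {b₀ CE : ℝ}
    (hM : ∀ t : ℝ, 2 ≤ t → |∑ p ∈ Nat.primesLE ⌊t⌋₊, r p / p - (Real.log (Real.log t) + b₀)| ≤
      CE / Real.log t ^ 2) : 0 ≤ CE := by
  have h := (abs_nonneg _).trans (hM 2 le_rfl)
  rwa [le_div_iff₀ (pow_pos (Real.log_pos one_lt_two) 2), zero_mul] at h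

/-- **Abel summation of prime sums against `log log`** (wrapper around the tree's
`Iwaniec1978.abs_sum_mul_sub_integral_le`): if `|∑_{p ≤ t} r(p)/p − (log log t + b₀)| ≤ C_E/log² t`
for `t ≥ 2`, then for `2 ≤ a ≤ b < x` and `G ∈ C¹[α, β]` (`α = log a/log x`, `β = log b/log x`)
`|∑_{⌊a⌋ < p ≤ ⌊b⌋} (r(p)/p) G(log p/log x) − ∫_α^β G(v) dv/v| ≤ (|G(α)| + |G(β)| + ∫_α^β |G'|)·C_E/log² a`.
[cite: IwaniecInventiones1978, p. 186] -/
theorem abs_primeSum_sub_integral_le {r : ℕ → ℝ} {b₀ CE : ℝ}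
    (hM : ∀ t : ℝ, 2 ≤ t → |∑ p ∈ Nat.primesLE ⌊t⌋₊, r p / p - (Real.log (Real.log t) + b₀)| ≤
      CE / Real.log t ^ 2)
    {x a b : ℝ} (ha : 2 ≤ a) (hab : a ≤ b) (hbx : b < x) {G G' : ℝ → ℝ}
    (hG : ∀ v ∈ Set.Icc (Real.log a / Real.log x) (Real.log b / Real.log x), HasDerivAt G (G' v) v)
    (hG' : ContinuousOn G' (Set.Icc (Real.log a / Real.log x) (Real.log b / Real.log x))) :
    |∑ p ∈ (Finset.Ioc ⌊a⌋₊ ⌊b⌋₊).filter Nat.Prime, r p / p * G (Real.log p / Real.log x) -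
        ∫ v in (Real.log a / Real.log x)..(Real.log b / Real.log x), G v / v| ≤
      (|G (Real.log a / Real.log x)| + |G (Real.log b / Real.log x)| +
        ∫ v in (Real.log a / Real.log x)..(Real.log b / Real.log x), |G' v|) *
        (CE / Real.log a ^ 2) := by
  set L := Real.log x with hL
  set α := Real.log a / L with hα
  set β := Real.log b / L with hβ
  have ha0 : 0 < a := by linarith
  have hb0 : 0 < b := by linarith
  have hx1 : 1 < x := by linarith
  have hL0 : 0 < L := Real.log_pos hx1
  have hla : 0 < Real.log a := Real.log_pos (by linarith)
  have hα0 : 0 < α := div_pos hla hL0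
  have hαβ : α ≤ β := div_le_div_of_nonneg_right (Real.log_le_log ha0 hab) hL0.le
  have hCE : 0 ≤ CE := mertensConst_nonneg hM
  -- the weights and the Mertens error
  set c : ℕ → ℝ := fun k => if k.Prime then r k / k else 0 with hc
  set E : ℝ → ℝ := fun t => Iwaniec1978.psum c t - Real.log (Real.log t) - b₀ with hE
  have hpsum : ∀ t : ℝ, Iwaniec1978.psum c t = ∑ p ∈ Nat.primesLE ⌊t⌋₊, r p / p := by
    intro t
    rw [Iwaniec1978.psum, Nat.primesLE, Nat.primesBelow, Finset.sum_filter, Finset.range_eq_Ico,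
      ← Finset.Ico_succ_right_eq_Icc]
    rfl
  have hEdef : ∀ t : ℝ, 1 < t → Iwaniec1978.psum c t = Real.log (Real.log t) + b₀ + E t := by
    intro t _; simp only [hE]; ring
  have hrpow : ∀ {c : ℝ}, 0 < c → x ^ (Real.log c / L) = c := fun {c} hc => by
    rw [Real.rpow_def_of_pos (by linarith), mul_div_cancel₀ _ hL0.ne', Real.exp_log hc]
  have hxα : x ^ α = a := hrpow ha0
  have hxβ : x ^ β = b := hrpow hb0
  have hδ : ∀ t : ℝ, x ^ α ≤ t → t ≤ x ^ β → |E t| ≤ CE / Real.log a ^ 2 := by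
    intro t hat _
    rw [hxα] at hat
    have ht2 : 2 ≤ t := ha.trans hat
    have h := hM t ht2
    rw [← hpsum] at h
    have hE' : E t = Iwaniec1978.psum c t - (Real.log (Real.log t) + b₀) := by simp only [hE]; ring
    rw [hE']
    exact h.trans (div_le_div_of_nonneg_left hCE (pow_pos hla 2)
      (pow_le_pow_left₀ hla.le (Real.log_le_log ha0 hat) 2))
  have h := Iwaniec1978.abs_sum_mul_sub_integral_le hEdef hx1 hα0 hαβ hG hG' hδ
  rw [hxα, hxβ] at h
  -- the sum over `Ioc ⌊a⌋ ⌊b⌋` with the weights `c` is the prime sum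
  have hsum : ∑ k ∈ Finset.Ioc ⌊a⌋₊ ⌊b⌋₊, G (Real.log k / L) * c k =
      ∑ p ∈ (Finset.Ioc ⌊a⌋₊ ⌊b⌋₊).filter Nat.Prime, r p / p * G (Real.log p / L) := by
    rw [Finset.sum_filter]
    refine Finset.sum_congr rfl fun k _ => ?_
    simp only [hc]
    split_ifs
    · ring
    · rw [mul_zero]
  rwa [hsum] at h

/-! ### `∑ r(p)/(p log² p)` -/

/-- **`∑_{⌊a⌋ < p ≤ ⌊b⌋} r(p)/(p log² p) ≤ (1/2 + 3 C_E)/log² a`** for `e ≤ a ≤ b < x` (any `x`; the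
weight `G(v) = 1/(vL)²` in `abs_primeSum_sub_integral_le`: `∫_α^β dv/(L² v³) ≤ 1/(2 log² a)`, and
`|G(α)| + |G(β)| + ∫|G'| ≤ 3/log² a ≤ 3`). [folklore] -/
theorem sum_prime_div_mul_log_sq_le {r : ℕ → ℝ} {b₀ CE : ℝ}
    (hM : ∀ t : ℝ, 2 ≤ t → |∑ p ∈ Nat.primesLE ⌊t⌋₊, r p / p - (Real.log (Real.log t) + b₀)| ≤
      CE / Real.log t ^ 2)
    {x a b : ℝ} (ha : Real.exp 1 ≤ a) (hab : a ≤ b) (hbx : b < x) :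
    ∑ p ∈ (Finset.Ioc ⌊a⌋₊ ⌊b⌋₊).filter Nat.Prime, r p / (p * Real.log p ^ 2) ≤
      (1 / 2 + 3 * CE) / Real.log a ^ 2 := by
  set L := Real.log x with hL
  set α := Real.log a / L with hα
  set β := Real.log b / L with hβ
  have ha2 : 2 ≤ a := le_trans (by have := Real.add_one_le_exp (1 : ℝ); linarith) ha
  have ha0 : 0 < a := by linarith
  have hb0 : 0 < b := by linarith
  have hL0 : 0 < L := Real.log_pos (by linarith)
  have hla1 : 1 ≤ Real.log a := by rwa [Real.le_log_iff_exp_le ha0]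
  have hla : 0 < Real.log a := by linarith
  have hα0 : 0 < α := div_pos hla hL0
  have hαβ : α ≤ β := div_le_div_of_nonneg_right (Real.log_le_log ha0 hab) hL0.le
  have hCE : 0 ≤ CE := mertensConst_nonneg hM
  have hαL : α * L = Real.log a := by simp only [hα]; field_simp
  -- the weight `G(v) = 1/(vL)²`
  set G : ℝ → ℝ := fun v => 1 / (v * L) ^ 2 with hG
  set G' : ℝ → ℝ := fun v => -2 * L / (v * L) ^ 3 with hG'
  have hvpos : ∀ v ∈ Set.Icc α β, 0 < v := fun v hv => hα0.trans_le hv.1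
  have hGd : ∀ v ∈ Set.Icc α β, HasDerivAt G (G' v) v := by
    intro v hv
    have hv0 : 0 < v := hvpos v hv
    have h1 : HasDerivAt (fun v : ℝ => (v * L) ^ 2) (2 * (v * L) * L) v := by
      simpa using ((hasDerivAt_id v).mul_const L).fun_pow 2
    have h2 : HasDerivAt (fun v : ℝ => ((v * L) ^ 2)⁻¹) (-(2 * (v * L) * L) / ((v * L) ^ 2) ^ 2) v :=
      h1.fun_inv (by positivity : (v * L) ^ 2 ≠ 0)
    have h3 : HasDerivAt G (-(2 * (v * L) * L) / ((v * L) ^ 2) ^ 2) v := by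
      refine h2.congr_of_eventuallyEq (Filter.Eventually.of_forall fun s => ?_)
      simp only [hG, one_div]
    refine h3.congr_deriv ?_
    simp only [hG']
    have : (v * L) ≠ 0 := by positivity
    field_simp
  have hG'c : ContinuousOn G' (Set.Icc α β) := by
    simp only [hG']
    refine continuousOn_const.div ((continuousOn_id.mul continuousOn_const).pow 3) fun v hv => ?_
    have := hvpos v hv
    positivity
  have hwrap := abs_primeSum_sub_integral_le hM ha2 hab hbx hGd hG'c
  -- the sum is the prime sum of the statement
  have hsum : ∑ p ∈ (Finset.Ioc ⌊a⌋₊ ⌊b⌋₊).filter Nat.Prime, r p / p * G (Real.log p / L) =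
      ∑ p ∈ (Finset.Ioc ⌊a⌋₊ ⌊b⌋₊).filter Nat.Prime, r p / (p * Real.log p ^ 2) := by
    refine Finset.sum_congr rfl fun p hp => ?_
    have hp2 : 2 ≤ p := (Finset.mem_filter.mp hp).2.two_le
    have hp0 : (0 : ℝ) < p := by exact_mod_cast (by omega : 0 < p)
    have hlp : 0 < Real.log p := Real.log_pos (by exact_mod_cast (by omega : 1 < p))
    simp only [hG]
    field_simp
  rw [hsum] at hwrap
  -- the main integral `∫_α^β dv/(L² v³) = (1/α² − 1/β²)/(2L²) ≤ 1/(2 log² a)`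
  have hint : ∫ v in α..β, G v / v = (1 / (α * L) ^ 2 - 1 / (β * L) ^ 2) / 2 := by
    have hderiv : ∀ v ∈ Set.uIcc α β,
        HasDerivAt (fun v : ℝ => -(1 / (v * L) ^ 2) / 2) (G v / v) v := by
      intro v hv
      rw [Set.uIcc_of_le hαβ] at hv
      have hv0 : 0 < v := hvpos v hv
      have h := ((hGd v hv).neg).div_const 2
      refine h.congr_deriv ?_
      simp only [hG, hG']
      have : (v * L) ≠ 0 := by positivity
      field_simp
    have hcont : ContinuousOn (fun v => G v / v) (Set.Icc α β) := by
      refine ContinuousOn.div ?_ continuousOn_id fun v hv => (hvpos v hv).ne'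
      simp only [hG]
      refine continuousOn_const.div ((continuousOn_id.mul continuousOn_const).pow 2) fun v hv => ?_
      have := hvpos v hv
      positivity
    rw [intervalIntegral.integral_eq_sub_of_hasDerivAt hderiv (hcont.intervalIntegrable_of_Icc hαβ)]
    ring
  have hmain : ∫ v in α..β, G v / v ≤ 1 / (2 * Real.log a ^ 2) := by
    rw [hint, hαL]
    have : 0 ≤ 1 / (β * L) ^ 2 := by positivity
    have h2 : (1 / Real.log a ^ 2 - 1 / (β * L) ^ 2) / 2 ≤ (1 / Real.log a ^ 2) / 2 := by linarith
    refine h2.trans (le_of_eq ?_)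
    field_simp
  -- the error factor `|G α| + |G β| + ∫|G'| ≤ 3`
  have hGα : |G α| ≤ 1 := by
    simp only [hG, hαL]
    rw [abs_of_nonneg (by positivity)]
    exact div_le_one_of_le₀ (one_le_pow₀ hla1) (by positivity)
  have hGβ : |G β| ≤ 1 := by
    have hβL : β * L = Real.log b := by simp only [hβ]; field_simp
    have hlb1 : 1 ≤ Real.log b := hla1.trans (Real.log_le_log ha0 hab)
    simp only [hG, hβL]
    rw [abs_of_nonneg (by positivity)]
    exact div_le_one_of_le₀ (one_le_pow₀ hlb1) (by positivity)
  have hG'int : ∫ v in α..β, |G' v| ≤ 1 := by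
    -- `|G'| = −G'` and `∫ (−G') = G α − G β ≤ G α ≤ 1`
    have hneg : ∀ v ∈ Set.Icc α β, |G' v| = -G' v := by
      intro v hv
      have hv0 : 0 < v := hvpos v hv
      have : G' v ≤ 0 := by
        simp only [hG']
        exact div_nonpos_of_nonpos_of_nonneg (by linarith) (by positivity)
      rw [abs_of_nonpos this]
    have hderiv : ∀ v ∈ Set.uIcc α β, HasDerivAt (fun v => -G v) (-G' v) v := by
      intro v hv
      rw [Set.uIcc_of_le hαβ] at hv
      exact (hGd v hv).neg
    have hcont : ContinuousOn (fun v => -G' v) (Set.Icc α β) := hG'c.neg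
    rw [intervalIntegral.integral_congr fun v hv => hneg v (by rwa [Set.uIcc_of_le hαβ] at hv),
      intervalIntegral.integral_eq_sub_of_hasDerivAt hderiv (hcont.intervalIntegrable_of_Icc hαβ)]
    have hGβ0 : 0 ≤ G β := by simp only [hG]; positivity
    linarith [(le_abs_self _).trans hGα]
  have hfac : (|G α| + |G β| + ∫ v in α..β, |G' v|) * (CE / Real.log a ^ 2) ≤ 3 * CE / Real.log a ^ 2 :=
    le_trans (mul_le_mul_of_nonneg_right (show |G α| + |G β| + ∫ v in α..β, |G' v| ≤ 3 by linarith)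
      (by positivity)) (le_of_eq (by ring))
  have h := (le_abs_self _).trans (hwrap.trans hfac)
  calc ∑ p ∈ (Finset.Ioc ⌊a⌋₊ ⌊b⌋₊).filter Nat.Prime, r p / (p * Real.log p ^ 2)
      ≤ (∫ v in α..β, G v / v) + 3 * CE / Real.log a ^ 2 := by linarith
    _ ≤ 1 / (2 * Real.log a ^ 2) + 3 * CE / Real.log a ^ 2 := by linarith
    _ = (1 / 2 + 3 * CE) / Real.log a ^ 2 := by field_simp

/-! ### The boundary-layer sum -/

/-- **`∑_{⌊a⌋ < p ≤ ⌊b⌋} (r(p)/p)/(1 + log x − 2 log p)² ≤ (1/2 + 3 C_E)/log a`** for `e ≤ a ≤ b` with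
`2 log b ≤ log x` (weight `G(v) = 1/(1 + L(1 − 2v))²`, increasing and `≤ 1` on `[α, β]`;
`∫_α^β G dv/v ≤ (1/α) [1/(2L(1 + L(1 − 2v)))]_α^β ≤ 1/(2 log a)`). [folklore] -/
theorem sum_prime_boundaryLayer_le {r : ℕ → ℝ} {b₀ CE : ℝ}
    (hM : ∀ t : ℝ, 2 ≤ t → |∑ p ∈ Nat.primesLE ⌊t⌋₊, r p / p - (Real.log (Real.log t) + b₀)| ≤
      CE / Real.log t ^ 2)
    {x a b : ℝ} (ha : Real.exp 1 ≤ a) (hab : a ≤ b) (hx0 : 0 < x) (hbx : 2 * Real.log b ≤ Real.log x) :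
    ∑ p ∈ (Finset.Ioc ⌊a⌋₊ ⌊b⌋₊).filter Nat.Prime,
        r p / p * (1 / (1 + Real.log x - 2 * Real.log p) ^ 2) ≤
      (1 / 2 + 3 * CE) / Real.log a := by
  set L := Real.log x with hL
  set α := Real.log a / L with hα
  set β := Real.log b / L with hβ
  have ha2 : 2 ≤ a := le_trans (by have := Real.add_one_le_exp (1 : ℝ); linarith) ha
  have ha0 : 0 < a := by linarith
  have hla1 : 1 ≤ Real.log a := by rwa [Real.le_log_iff_exp_le ha0]
  have hla : 0 < Real.log a := by linarith
  have hlb : Real.log a ≤ Real.log b := Real.log_le_log ha0 hab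
  have hbx' : b < x := by
    have h1 : Real.log b < Real.log x := by linarith
    by_contra h
    push Not at h
    have := Real.log_le_log hx0 h
    linarith
  have hL0 : 0 < L := Real.log_pos (by linarith)
  have hα0 : 0 < α := div_pos hla hL0
  have hαβ : α ≤ β := div_le_div_of_nonneg_right hlb hL0.le
  have hCE : 0 ≤ CE := mertensConst_nonneg hM
  have hαL : α * L = Real.log a := by simp only [hα]; field_simp
  have hβL : β * L = Real.log b := by simp only [hβ]; field_simp
  -- `D(v) = 1 + L(1 − 2v) ≥ 1` on `[α, β]`
  have hD : ∀ v ∈ Set.Icc α β, 1 ≤ 1 + L * (1 - 2 * v) := by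
    intro v hv
    have h1 : L * v ≤ Real.log b := by
      calc L * v ≤ L * β := mul_le_mul_of_nonneg_left hv.2 hL0.le
        _ = Real.log b := by rw [mul_comm, hβL]
    nlinarith
  -- the weight
  set G : ℝ → ℝ := fun v => 1 / (1 + L * (1 - 2 * v)) ^ 2 with hG
  set G' : ℝ → ℝ := fun v => 4 * L / (1 + L * (1 - 2 * v)) ^ 3 with hG'
  have hGd : ∀ v ∈ Set.Icc α β, HasDerivAt G (G' v) v := by
    intro v hv
    have hDv := hD v hv
    have h0 : HasDerivAt (fun v : ℝ => 1 + L * (1 - 2 * v)) (L * (0 - 2 * 1)) v := by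
      have h := ((hasDerivAt_const v (1:ℝ)).sub ((hasDerivAt_id v).const_mul 2)).const_mul L
      simpa using h.const_add 1
    have h1 : HasDerivAt (fun v : ℝ => (1 + L * (1 - 2 * v)) ^ 2)
        ((2 : ℕ) * (1 + L * (1 - 2 * v)) ^ (2 - 1) * (L * (0 - 2 * 1))) v := h0.fun_pow 2
    have h2 : HasDerivAt (fun v : ℝ => ((1 + L * (1 - 2 * v)) ^ 2)⁻¹)
        (-((2 : ℕ) * (1 + L * (1 - 2 * v)) ^ (2 - 1) * (L * (0 - 2 * 1))) /
          ((1 + L * (1 - 2 * v)) ^ 2) ^ 2) v :=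
      h1.fun_inv (by positivity : (1 + L * (1 - 2 * v)) ^ 2 ≠ 0)
    have h3 : HasDerivAt G (-((2 : ℕ) * (1 + L * (1 - 2 * v)) ^ (2 - 1) * (L * (0 - 2 * 1))) /
          ((1 + L * (1 - 2 * v)) ^ 2) ^ 2) v := by
      refine h2.congr_of_eventuallyEq (Filter.Eventually.of_forall fun s => ?_)
      simp only [hG, one_div]
    refine h3.congr_deriv ?_
    simp only [hG']
    have : (1 + L * (1 - 2 * v)) ≠ 0 := by positivity
    push_cast
    field_simp
    ring
  have hG'c : ContinuousOn G' (Set.Icc α β) := by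
    simp only [hG']
    refine continuousOn_const.div ?_ fun v hv => ?_
    · exact (continuousOn_const.add (continuousOn_const.mul
        (continuousOn_const.sub (continuousOn_const.mul continuousOn_id)))).pow 3
    · have := hD v hv
      positivity
  have hwrap := abs_primeSum_sub_integral_le hM ha2 hab hbx' hGd hG'c
  -- the sum is the prime sum of the statement
  have hsum : ∑ p ∈ (Finset.Ioc ⌊a⌋₊ ⌊b⌋₊).filter Nat.Prime, r p / p * G (Real.log p / L) =
      ∑ p ∈ (Finset.Ioc ⌊a⌋₊ ⌊b⌋₊).filter Nat.Prime,
        r p / p * (1 / (1 + Real.log x - 2 * Real.log p) ^ 2) := by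
    refine Finset.sum_congr rfl fun p _ => ?_
    simp only [hG]
    congr 2
    field_simp
    ring
  rw [hsum] at hwrap
  -- the main integral
  have hGle : ∀ v ∈ Set.Icc α β, G v ≤ 1 := by
    intro v hv
    simp only [hG]
    exact div_le_one_of_le₀ (one_le_pow₀ (hD v hv)) (by positivity)
  have hG0 : ∀ v ∈ Set.Icc α β, 0 ≤ G v := fun v hv => by simp only [hG]; positivity
  have hGc : ContinuousOn G (Set.Icc α β) := fun v hv => (hGd v hv).continuousAt.continuousWithinAt
  have hmain : ∫ v in α..β, G v / v ≤ 1 / (2 * Real.log a) := by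
    -- `G v / v ≤ G v / α` and `∫ G = [1/(2L D)]_α^β ≤ 1/(2L)`
    have h1 : ∫ v in α..β, G v / v ≤ ∫ v in α..β, G v / α := by
      refine intervalIntegral.integral_mono_on hαβ ?_ ?_ fun v hv => ?_
      · exact (hGc.div continuousOn_id fun v hv => (hα0.trans_le hv.1).ne').intervalIntegrable_of_Icc hαβ
      · exact (hGc.div_const α).intervalIntegrable_of_Icc hαβ
      · exact div_le_div_of_nonneg_left (hG0 v hv) hα0 hv.1
    have hprim : ∫ v in α..β, G v = 1 / (2 * L * (1 + L * (1 - 2 * β))) -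
        1 / (2 * L * (1 + L * (1 - 2 * α))) := by
      have hderiv : ∀ v ∈ Set.uIcc α β,
          HasDerivAt (fun v : ℝ => 1 / (2 * L * (1 + L * (1 - 2 * v)))) (G v) v := by
        intro v hv
        rw [Set.uIcc_of_le hαβ] at hv
        have hDv := hD v hv
        have h0 : HasDerivAt (fun v : ℝ => 1 + L * (1 - 2 * v)) (L * (0 - 2 * 1)) v := by
          have h := ((hasDerivAt_const v (1:ℝ)).sub ((hasDerivAt_id v).const_mul 2)).const_mul L
          simpa using h.const_add 1
        have h1 : HasDerivAt (fun v : ℝ => 2 * L * (1 + L * (1 - 2 * v)))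
            (2 * L * (L * (0 - 2 * 1))) v := h0.const_mul (2 * L)
        have h2 : HasDerivAt (fun v : ℝ => (2 * L * (1 + L * (1 - 2 * v)))⁻¹)
            (-(2 * L * (L * (0 - 2 * 1))) / (2 * L * (1 + L * (1 - 2 * v))) ^ 2) v :=
          h1.fun_inv (by positivity : 2 * L * (1 + L * (1 - 2 * v)) ≠ 0)
        have h3 : HasDerivAt (fun v : ℝ => 1 / (2 * L * (1 + L * (1 - 2 * v))))
            (-(2 * L * (L * (0 - 2 * 1))) / (2 * L * (1 + L * (1 - 2 * v))) ^ 2) v := by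
          refine h2.congr_of_eventuallyEq (Filter.Eventually.of_forall fun s => ?_)
          simp only [one_div]
        refine h3.congr_deriv ?_
        simp only [hG]
        have : (1 + L * (1 - 2 * v)) ≠ 0 := by positivity
        field_simp
        ring
      rw [intervalIntegral.integral_eq_sub_of_hasDerivAt hderiv (hGc.intervalIntegrable_of_Icc hαβ)]
    have h2 : ∫ v in α..β, G v ≤ 1 / (2 * L) := by
      rw [hprim]
      have hDβ := hD β ⟨hαβ, le_rfl⟩
      have hDα := hD α ⟨le_rfl, hαβ⟩
      have e1 : 1 / (2 * L * (1 + L * (1 - 2 * β))) ≤ 1 / (2 * L) :=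
        div_le_div_of_nonneg_left zero_le_one (by positivity) (by nlinarith)
      linarith [show 0 ≤ 1 / (2 * L * (1 + L * (1 - 2 * α))) by positivity]
    rw [intervalIntegral.integral_div] at h1
    calc ∫ v in α..β, G v / v ≤ (∫ v in α..β, G v) / α := h1
      _ ≤ (1 / (2 * L)) / α := div_le_div_of_nonneg_right h2 hα0.le
      _ = 1 / (2 * Real.log a) := by rw [← hαL]; field_simp
  -- the error factor `≤ 3`
  have hGα : |G α| ≤ 1 := by rw [abs_of_nonneg (hG0 α ⟨le_rfl, hαβ⟩)]; exact hGle α ⟨le_rfl, hαβ⟩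
  have hGβ : |G β| ≤ 1 := by rw [abs_of_nonneg (hG0 β ⟨hαβ, le_rfl⟩)]; exact hGle β ⟨hαβ, le_rfl⟩
  have hG'int : ∫ v in α..β, |G' v| ≤ 1 := by
    have hpos : ∀ v ∈ Set.Icc α β, |G' v| = G' v := by
      intro v hv
      have := hD v hv
      exact abs_of_nonneg (by simp only [hG']; positivity)
    have hderiv : ∀ v ∈ Set.uIcc α β, HasDerivAt G (G' v) v := by
      intro v hv
      rw [Set.uIcc_of_le hαβ] at hv
      exact hGd v hv
    rw [intervalIntegral.integral_congr fun v hv => hpos v (by rwa [Set.uIcc_of_le hαβ] at hv),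
      intervalIntegral.integral_eq_sub_of_hasDerivAt hderiv (hG'c.intervalIntegrable_of_Icc hαβ)]
    linarith [hGle β ⟨hαβ, le_rfl⟩, hG0 α ⟨le_rfl, hαβ⟩]
  have hfac : (|G α| + |G β| + ∫ v in α..β, |G' v|) * (CE / Real.log a ^ 2) ≤ 3 * CE / Real.log a := by
    have h3 : |G α| + |G β| + ∫ v in α..β, |G' v| ≤ 3 := by linarith
    calc _ ≤ 3 * (CE / Real.log a ^ 2) := mul_le_mul_of_nonneg_right h3 (by positivity)
      _ = 3 * CE / Real.log a * (1 / Real.log a) := by field_simp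
      _ ≤ 3 * CE / Real.log a * 1 := by
          refine mul_le_mul_of_nonneg_left ?_ (by positivity)
          exact div_le_one_of_le₀ hla1 hla.le
      _ = 3 * CE / Real.log a := mul_one _
  have h := (le_abs_self _).trans (hwrap.trans hfac)
  calc ∑ p ∈ (Finset.Ioc ⌊a⌋₊ ⌊b⌋₊).filter Nat.Prime,
        r p / p * (1 / (1 + Real.log x - 2 * Real.log p) ^ 2)
      ≤ (∫ v in α..β, G v / v) + 3 * CE / Real.log a := by linarith
    _ ≤ 1 / (2 * Real.log a) + 3 * CE / Real.log a := by linarith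
    _ = (1 / 2 + 3 * CE) / Real.log a := by field_simp

end FriableMoebiusRoot

end Literature.NumberTheory.Sieve
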